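import Summits.AtomisticToContinuum.Crystallization.Theorems.ChargedEnergyGapBarlowResidual
import HarnessLib

/-!
# Charged energy gap — lens-3 g64, node «BarlowRef» (R3) — part 17 (addendum; imports the landed part 2 `…BarlowResidual` only, independent of parts 3–16): FINITE REDUCTION of the bulk far residue

The consumer glue (g65 item 1) feeds `TubeShareBoundH` — a statement about FINITE source / target sets `F, G ⊆ P.points` — into
`BulkFarResidueBoundB`, whose left side `bulkFarResidue` is a motif sum of `tsum`s (`excisionSum`).  This part isolates the analysis-free plumbing:

* ★ `tsum_tsum_le_of_sum_sum_le` / `sum_tsum_le_of_sum_sum_le` — a (double) `tsum` of a non-negative family is `≤ M` as soon as every FINITE double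
  partial sum is (`Real.tsum_le_of_sum_le` + `summable_of_sum_le`; no summability hypothesis needed);
* `excisionSum_eq_tsum_points` — `excisionSum P Y y` as a `tsum` over the `y`-INDEPENDENT index `{z // z ∈ P.points}`;
* ★ `sum_mul_excisionSum_le_of_finite` — `Σ_{y ∈ A} χ y · excisionSum P Y y ≤ M` whenever, for every finite `G ⊆ P.points`,
  `Σ_{y ∈ A} χ y · Σ_{z ∈ G, z ≠ y, z ∈ Y} (V′(d_yz))⁺ d_yz ≤ M` (`χ ≥ 0`);
* ★★ `bulkFarResidue_le_of_finite` — the same for `bulkFarResidue` (bulk sources `w_C = 1`, `transMult = 0`, `∉ X`, weight `localFactor`, targets in `X ∖ nearZone`);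
* ★★ `bulkFarResidue_le_of_finite_inv6` — with the kernel replaced by `(dist y z)⁻¹ ^ 6` (`(V′(d))⁺ d ≤ d⁻⁶` for every `d > 0`: `max_ljD1_mul_le` for `d ≥ 1`,
  `max_ljD1_eq_zero` below) — the currency of `tubeLoad` / `TubeShareBoundH`.

So item 1 may be proved entirely with finite sums: exhibit blocks and shares for the pairs `(y, z) ∈ P.motif × G`, bound the member loads by
`TubeShareBoundH`, sum the budgets (part 7 / part 9), uniformly in `G`.  0 sorry; standard axioms.
-/

noncomputable section

open scoped Classical
open Literature.MathematicalPhysics.StatisticalMechanics Literature.Geometry.DiscreteGeometry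
open Summit.AtomisticToContinuum.Crystallization.Theses.PricedLinkCensus
open Summit.AtomisticToContinuum.Crystallization.Theorems.ChargedEnergyGapNegative

namespace Summit.AtomisticToContinuum.Crystallization.Theorems.ChargedEnergyGapChartDial

section FiniteReduction

/-- ★ A double `tsum` of a non-negative real family is at most `M` if every finite double partial sum is. -/
theorem tsum_tsum_le_of_sum_sum_le {α β : Type*} (f : α → β → ℝ) (h0 : ∀ a b, 0 ≤ f a b) {M : ℝ}
    (h : ∀ (F : Finset α) (G : Finset β), ∑ a ∈ F, ∑ b ∈ G, f a b ≤ M) : ∑' a, ∑' b, f a b ≤ M := by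
  have hrow : ∀ a, Summable (f a) := fun a =>
    summable_of_sum_le (fun b => h0 a b) (c := M) fun G => by simpa using h {a} G
  refine Real.tsum_le_of_sum_le (fun a => tsum_nonneg (h0 a)) fun F => ?_
  rw [← Summable.tsum_finsetSum (fun a _ => hrow a)]
  refine Real.tsum_le_of_sum_le (fun b => Finset.sum_nonneg fun a _ => h0 a b) fun G => ?_
  rw [Finset.sum_comm]
  exact h F G

/-- The same with a finite outer sum: `Σ_{a ∈ A} Σ'_b f a b ≤ M` if `Σ_{a ∈ A} Σ_{b ∈ G} f a b ≤ M` for every finite `G`. -/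
theorem sum_tsum_le_of_sum_sum_le {α β : Type*} (A : Finset α) (f : α → β → ℝ) (h0 : ∀ a b, 0 ≤ f a b) {M : ℝ}
    (h : ∀ G : Finset β, ∑ a ∈ A, ∑ b ∈ G, f a b ≤ M) : ∑ a ∈ A, ∑' b, f a b ≤ M := by
  have hrow : ∀ a ∈ A, Summable (f a) := fun a ha =>
    summable_of_sum_le (fun b => h0 a b) (c := M) fun G =>
      (Finset.single_le_sum (f := fun a => ∑ b ∈ G, f a b) (fun a _ => Finset.sum_nonneg fun b _ => h0 a b) ha).trans (h G)
  rw [← Summable.tsum_finsetSum hrow]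
  refine Real.tsum_le_of_sum_le (fun b => Finset.sum_nonneg fun a _ => h0 a b) fun G => ?_
  rw [Finset.sum_comm]
  exact h G

variable (P : PeriodicConfiguration 3)

/-- `excisionSum P Y y` over the `y`-independent index `{z // z ∈ P.points}` (the diagonal term is excluded by the test `z ≠ y`). -/
theorem excisionSum_eq_tsum_points (Y : Set E3) (y : E3) :
    excisionSum P Y y = ∑' z : {z : E3 // z ∈ P.points}, if (z : E3) ≠ y ∧ (z : E3) ∈ Y then max (ljD1 (dist y z)) 0 * dist y (z : E3) else 0 := by
  unfold excisionSum
  have h1 := tsum_subtype (s := {z : E3 | z ∈ P.points ∧ z ≠ y}) (fun z : E3 => if z ∈ Y then max (ljD1 (dist y z)) 0 * dist y z else 0)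
  have h2 := tsum_subtype (s := P.points) (fun z : E3 => if z ≠ y ∧ z ∈ Y then max (ljD1 (dist y z)) 0 * dist y z else 0)
  have hind : Set.indicator {z : E3 | z ∈ P.points ∧ z ≠ y} (fun z : E3 => if z ∈ Y then max (ljD1 (dist y z)) 0 * dist y z else 0) =
      Set.indicator P.points (fun z : E3 => if z ≠ y ∧ z ∈ Y then max (ljD1 (dist y z)) 0 * dist y z else 0) := by
    funext x
    simp only [Set.indicator_apply, Set.mem_setOf_eq]
    by_cases hx : x ∈ P.points
    · by_cases hxy : x = y <;> simp [hx, hxy]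
    · simp [hx]
  exact h1.trans (hind ▸ h2.symm)

/-- ★ FINITE REDUCTION for weighted excision sums: `χ ≥ 0` and, for every finite `G ⊆ P.points`,
`Σ_{y ∈ A} χ y · Σ_{z ∈ G, z ≠ y, z ∈ Y} (V′(d_yz))⁺ d_yz ≤ M` ⟹ `Σ_{y ∈ A} χ y · excisionSum P Y y ≤ M`. -/
theorem sum_mul_excisionSum_le_of_finite (A : Finset E3) (χ : E3 → ℝ) (hχ : ∀ y, 0 ≤ χ y) (Y : Set E3) {M : ℝ}
    (h : ∀ G : Finset E3, ↑G ⊆ P.points →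
      ∑ y ∈ A, χ y * ∑ z ∈ G, (if z ≠ y ∧ z ∈ Y then max (ljD1 (dist y z)) 0 * dist y z else 0) ≤ M) :
    ∑ y ∈ A, χ y * excisionSum P Y y ≤ M := by
  set f : E3 → {z : E3 // z ∈ P.points} → ℝ := fun y z =>
    χ y * (if (z : E3) ≠ y ∧ (z : E3) ∈ Y then max (ljD1 (dist y z)) 0 * dist y (z : E3) else 0) with hf
  have h0 : ∀ y z, 0 ≤ f y z := fun y z => by
    simp only [hf]
    refine mul_nonneg (hχ y) ?_
    split_ifs
    · exact mul_nonneg (le_max_right _ _) dist_nonneg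
    · exact le_rfl
  have hre : ∀ y ∈ A, χ y * excisionSum P Y y = ∑' z : {z : E3 // z ∈ P.points}, f y z := fun y _ => by
    rw [excisionSum_eq_tsum_points, ← tsum_mul_left]
  rw [Finset.sum_congr rfl hre]
  refine sum_tsum_le_of_sum_sum_le A f h0 fun S => ?_
  have hG : ↑(S.map (Function.Embedding.subtype _)) ⊆ P.points := by
    intro z hz
    rw [Finset.coe_map, Set.mem_image] at hz
    obtain ⟨w, -, rfl⟩ := hz
    exact w.2
  have key := h (S.map (Function.Embedding.subtype _)) hG
  refine le_of_eq_of_le ?_ key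
  refine Finset.sum_congr rfl fun y _ => ?_
  rw [Finset.sum_map, Finset.mul_sum]
  rfl

variable (ϱχ : ℝ) {m : ℕ} (D : Fin m → Set E3) (σ : Fin m → Bool) (X : Set E3) (ϱ : ℝ) (C : Set E3)

/-- ★★ FINITE REDUCTION of the bulk far residue: if for every finite `G ⊆ P.points`
`Σ_{y ∈ motif, bulk} localFactor(y) · Σ_{z ∈ G, z ≠ y, z ∈ X ∖ nearZone} (V′(d_yz))⁺ d_yz ≤ M`, then `bulkFarResidue ≤ M`. -/
theorem bulkFarResidue_le_of_finite {M : ℝ}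
    (h : ∀ G : Finset E3, ↑G ⊆ P.points →
      ∑ y ∈ P.motif, (if y ∉ X ∧ profileWeight ϱ C y = 1 ∧ transMult ϱχ D y = 0 then localFactor ϱχ D σ y else 0) *
        ∑ z ∈ G, (if z ≠ y ∧ z ∈ X \ nearZone ϱχ D σ P X ϱ C then max (ljD1 (dist y z)) 0 * dist y z else 0) ≤ M) :
    bulkFarResidue ϱχ D σ P X ϱ C ≤ M := by
  have hχ : ∀ y, 0 ≤ (if y ∉ X ∧ profileWeight ϱ C y = 1 ∧ transMult ϱχ D y = 0 then localFactor ϱχ D σ y else 0) := fun y => by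
    split_ifs
    · exact localFactor_nonneg (ϱχ := ϱχ) (D := D) (σ := σ) y
    · exact le_rfl
  have hre : bulkFarResidue ϱχ D σ P X ϱ C = ∑ y ∈ P.motif,
      (if y ∉ X ∧ profileWeight ϱ C y = 1 ∧ transMult ϱχ D y = 0 then localFactor ϱχ D σ y else 0) *
        excisionSum P (X \ nearZone ϱχ D σ P X ϱ C) y := by
    unfold bulkFarResidue
    refine Finset.sum_congr rfl fun y _ => ?_
    split_ifs <;> simp
  rw [hre]
  refine sum_mul_excisionSum_le_of_finite P P.motif _ hχ _ fun G hG => ?_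
  -- the `Decidable` instances of the target test differ (`Set.decidableSdiff` vs. classical): `convert` closes them
  convert h G hG using 3 with y _
  exact Finset.sum_congr rfl fun z _ => by congr 1

/-- The kernel comparison `(V′(d))⁺ · d ≤ d⁻⁶` for every `d > 0`. -/
theorem max_ljD1_mul_le_inv_pow_six {t : ℝ} (ht : 0 < t) : max (ljD1 t) 0 * t ≤ t⁻¹ ^ 6 := by
  rcases le_or_gt 1 t with h1 | h1
  · simpa using max_ljD1_mul_le h1
  · rw [max_ljD1_eq_zero ht h1.le, zero_mul]
    positivity

/-- ★★ FINITE REDUCTION in the `tubeLoad` currency: if for every finite `G ⊆ P.points`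
`Σ_{y ∈ motif, bulk} localFactor(y) · Σ_{z ∈ G, z ≠ y, z ∈ X ∖ nearZone} (dist y z)⁻¹^6 ≤ M`, then `bulkFarResidue ≤ M`. -/
theorem bulkFarResidue_le_of_finite_inv6 {M : ℝ}
    (h : ∀ G : Finset E3, ↑G ⊆ P.points →
      ∑ y ∈ P.motif, (if y ∉ X ∧ profileWeight ϱ C y = 1 ∧ transMult ϱχ D y = 0 then localFactor ϱχ D σ y else 0) *
        ∑ z ∈ G, (if z ≠ y ∧ z ∈ X \ nearZone ϱχ D σ P X ϱ C then (dist y z)⁻¹ ^ 6 else 0) ≤ M) :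
    bulkFarResidue ϱχ D σ P X ϱ C ≤ M := by
  refine bulkFarResidue_le_of_finite P ϱχ D σ X ϱ C fun G hG => (Finset.sum_le_sum fun y _ => ?_).trans (h G hG)
  have hχ : 0 ≤ (if y ∉ X ∧ profileWeight ϱ C y = 1 ∧ transMult ϱχ D y = 0 then localFactor ϱχ D σ y else 0) := by
    split_ifs
    · exact localFactor_nonneg (ϱχ := ϱχ) (D := D) (σ := σ) y
    · exact le_rfl
  refine mul_le_mul_of_nonneg_left (Finset.sum_le_sum fun z _ => ?_) hχ
  split_ifs with hz
  · have hd : 0 < dist y z := dist_pos.2 (Ne.symm hz.1)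
    exact max_ljD1_mul_le_inv_pow_six hd
  · exact le_rfl

end FiniteReduction

end Summit.AtomisticToContinuum.Crystallization.Theorems.ChargedEnergyGapChartDial

end
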